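import Literature.Geometry.Lorentzian.DecaySymbols
import HarnessLib

/-!
# Smooth symbols at infinity: the inverse of an elliptic symbol

Support file (all results proved, no definitions, no named facts), an addition to the symbol
calculus `IsBigOSmooth` of `DecaySymbols.lean`: if `g : E → ℝ` is a smooth symbol of order `b`
to second order AND elliptic at that order, `g(y) ≥ c‖y‖^b` far out for some `c > 0`, then
`1/g` is a smooth symbol of order `−b` to second order (`IsBigOSmooth.inv_of_elliptic`):
`|1/g| ≤ c⁻¹ r^{−b}`, `D(1/g) = −Dg/g²` has norm `≲ r^{−2b} r^{b−1} = r^{−b−1}`, and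
`D²(1/g) = −D²g/g² + 2 Dg ⊗ Dg/g³` has norm `≲ r^{−b−2}`. This is the missing inversion rule of
the `O_k(r^a)` bookkeeping (Schoen–Yau 1979, (1.1): `g_{ij} = (1 + M/2r)⁴δ + O(r⁻²)` ⇒ `g^{ij} = …`),
used for the coefficient `a²(Σ + 2MR)/Σ`, `Σ = R² + a²cos²θ ≍ r²`, of the axial term of the
Boyer–Lindquist slice metric of Kerr in quasi-isotropic coordinates.

References: R. Schoen, S.-T. Yau, Comm. Math. Phys. 65 (1979), §1, (1.1); R. Bartnik, CPAM 39
(1986), Def. 2.1 and Prop. 2.2 (weighted classes are closed under smooth functional calculus).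
-/

noncomputable section

open Filter Asymptotics Bornology Set
open scoped Topology ContDiff

namespace Literature.Geometry.Lorentzian

namespace IsBigOSmooth

variable {E : Type*} [NormedAddCommGroup E] [InnerProductSpace ℝ E] {b : ℝ} {g : E → ℝ}

/-- **The inverse of an elliptic symbol.** If `g = O₂(r^b)` is a smooth symbol with
`g(y) ≥ c ‖y‖^b` far out (`c > 0`), then `1/g = O₂(r^{−b})` is a smooth symbol of order `−b`:
`D(1/g) = −g⁻² Dg`, `D²(1/g) = −g⁻² D²g + 2g⁻³ Dg ⊗ Dg`. Bartnik 1986, Prop. 2.2 (functional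
calculus in weighted classes); Schoen–Yau 1979, (1.1). [cite: Bartnik1986, Prop. 2.2] -/
theorem inv_of_elliptic (hg : IsBigOSmooth 2 b g) {c : ℝ} (hc : 0 < c)
    (hlow : ∀ᶠ y in cobounded E, c * ‖y‖ ^ b ≤ g y) :
    IsBigOSmooth 2 (-b) fun y ↦ (g y)⁻¹ := by
  obtain ⟨⟨R₀, hR₀⟩, hO⟩ := hg
  -- a far radius beyond which `g` is smooth, `≥ c r^b > 0`, and `r ≥ 1`
  obtain ⟨R₁, -, hR₁⟩ := hasBasis_cobounded_norm.eventually_iff.1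
    (hlow.and (eventually_cobounded_le_norm (E := E) 1))
  set R : ℝ := max R₀ R₁ with hRdef
  have hfar : ∀ y : E, R < ‖y‖ → R₀ < ‖y‖ ∧ c * ‖y‖ ^ b ≤ g y ∧ 1 ≤ ‖y‖ := fun y hy ↦
    ⟨(le_max_left _ _).trans_lt hy,
      (hR₁ (show y ∈ {x : E | R₁ ≤ ‖x‖} from ((le_max_right _ _).trans hy.le))).1,
      (hR₁ (show y ∈ {x : E | R₁ ≤ ‖x‖} from ((le_max_right _ _).trans hy.le))).2⟩
  have hpow2 : ∀ y : E, ‖y‖ ^ (2 * b) = (‖y‖ ^ b) ^ 2 := fun y ↦ by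
    rw [mul_comm, Real.rpow_mul (norm_nonneg y), Real.rpow_two]
  have hpow3 : ∀ y : E, ‖y‖ ^ (3 * b) = (‖y‖ ^ b) ^ 3 := fun y ↦ by
    rw [mul_comm, Real.rpow_mul (norm_nonneg y), show (3 : ℝ) = ((3 : ℕ) : ℝ) by norm_num,
      Real.rpow_natCast]
  have hpos : ∀ y : E, R < ‖y‖ → 0 < g y := fun y hy ↦ by
    obtain ⟨-, h2, h3⟩ := hfar y hy
    exact (mul_pos hc (Real.rpow_pos_of_pos (by linarith) b)).trans_le h2
  set U : Set E := {y | R < ‖y‖} with hU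
  have hUo : IsOpen U := isOpen_setOf_lt_norm R
  have hgU : ContDiffOn ℝ ∞ g U := hR₀.mono (setOf_lt_norm_anti (le_max_left _ _))
  have hgC : ∀ y ∈ U, ContDiffAt ℝ ∞ g y := fun y hy ↦ hgU.contDiffAt (hUo.mem_nhds hy)
  -- smoothness of `1/g` far out
  have hinvU : ContDiffOn ℝ ∞ (fun y ↦ (g y)⁻¹) U := fun y hy ↦
    ((hgC y hy).inv (hpos y hy).ne').contDiffWithinAt
  -- the first derivative far out: `D(1/g) = −g⁻² • Dg`
  have hD1 : ∀ y ∈ U, HasFDerivAt (fun y ↦ (g y)⁻¹) ((-(g y ^ 2)⁻¹) • fderiv ℝ g y) y := fun y hy ↦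
    (hasDerivAt_inv (hpos y hy).ne').comp_hasFDerivAt y
      (((hgC y hy).differentiableAt (by simp)).hasFDerivAt)
  have hD1eq : ∀ y ∈ U, fderiv ℝ (fun y ↦ (g y)⁻¹) y = (-(g y ^ 2)⁻¹) • fderiv ℝ g y := fun y hy ↦
    (hD1 y hy).fderiv
  -- the pieces as `O(·)` statements
  have hφ : (fun y ↦ (g y ^ 2)⁻¹) =O[cobounded E] fun y ↦ ‖y‖ ^ (-(2 * b)) := by
    refine IsBigO.of_bound (c ^ 2)⁻¹ ?_
    filter_upwards [eventually_cobounded_lt_norm (E := E) R] with y hy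
    obtain ⟨-, h2, h3⟩ := hfar y hy
    have hyb : 0 < ‖y‖ ^ b := Real.rpow_pos_of_pos (by linarith) b
    have hgy := hpos y hy
    rw [Real.norm_of_nonneg (by positivity), Real.norm_of_nonneg (by positivity),
      Real.rpow_neg (by linarith), hpow2 y, ← mul_inv, ← mul_pow]
    exact inv_anti₀ (by positivity) (pow_le_pow_left₀ (by positivity) h2 2)
  have hψ : (fun y ↦ (g y ^ 3)⁻¹) =O[cobounded E] fun y ↦ ‖y‖ ^ (-(3 * b)) := by
    refine IsBigO.of_bound (c ^ 3)⁻¹ ?_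
    filter_upwards [eventually_cobounded_lt_norm (E := E) R] with y hy
    obtain ⟨-, h2, h3⟩ := hfar y hy
    have hyb : 0 < ‖y‖ ^ b := Real.rpow_pos_of_pos (by linarith) b
    have hgy := hpos y hy
    rw [Real.norm_of_nonneg (by positivity), Real.norm_of_nonneg (by positivity),
      Real.rpow_neg (by linarith), hpow3 y, ← mul_inv, ← mul_pow]
    exact inv_anti₀ (by positivity) (pow_le_pow_left₀ (by positivity) h2 3)
  have hDg : (fun y ↦ ‖fderiv ℝ g y‖) =O[cobounded E] fun y ↦ ‖y‖ ^ (b - 1) := by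
    have h := hO 1 (by norm_num)
    simpa only [norm_iteratedFDeriv_one, Nat.cast_one] using h
  have hD2g : (fun y ↦ ‖fderiv ℝ (fderiv ℝ g) y‖) =O[cobounded E] fun y ↦ ‖y‖ ^ (b - 2) := by
    have h := hO 2 le_rfl
    refine (h.congr_left fun y ↦ ?_).congr_right fun y ↦ by norm_num
    rw [← norm_iteratedFDeriv_fderiv, norm_iteratedFDeriv_one]
  refine ⟨⟨R, hinvU⟩, fun m hm ↦ ?_⟩
  interval_cases m
  · -- `m = 0`: `|1/g| ≤ c⁻¹ r^{−b}`
    refine IsBigO.of_bound c⁻¹ ?_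
    filter_upwards [eventually_cobounded_lt_norm (E := E) R] with y hy
    obtain ⟨-, h2, h3⟩ := hfar y hy
    have hyb : 0 < ‖y‖ ^ b := Real.rpow_pos_of_pos (by linarith) b
    have hgy := hpos y hy
    rw [norm_iteratedFDeriv_zero, norm_norm, Real.norm_of_nonneg (by positivity), Nat.cast_zero,
      sub_zero, Real.norm_of_nonneg (by positivity), Real.rpow_neg (by linarith), ← mul_inv]
    exact inv_anti₀ (by positivity) h2
  · -- `m = 1`: `‖D(1/g)‖ = g⁻² ‖Dg‖`
    have heq : (fun y ↦ ‖iteratedFDeriv ℝ 1 (fun y ↦ (g y)⁻¹) y‖) =ᶠ[cobounded E]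
        fun y ↦ (g y ^ 2)⁻¹ * ‖fderiv ℝ g y‖ := by
      filter_upwards [eventually_cobounded_lt_norm (E := E) R] with y hy
      rw [norm_iteratedFDeriv_one, hD1eq y hy, norm_smul, norm_neg, norm_inv, norm_pow,
        Real.norm_of_nonneg (hpos y hy).le]
    have hexp : (fun y : E ↦ ‖y‖ ^ (-(2 * b)) * ‖y‖ ^ (b - 1)) =ᶠ[cobounded E]
        fun y ↦ ‖y‖ ^ (-b - ((1 : ℕ) : ℝ)) := by
      rw [Nat.cast_one, show -b - 1 = -(2 * b) + (b - 1) by ring]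
      exact norm_rpow_mul_rpow_eventuallyEq (E := E) _ _
    exact (heq.trans_isBigO (hφ.mul hDg)).trans hexp.isBigO
  · -- `m = 2`: `D(−g⁻² • Dg) = −g⁻² • D²g + (2g⁻³ Dg) ⊗ Dg`
    have hφd : ∀ y ∈ U,
        HasFDerivAt (fun y ↦ -(g y ^ 2)⁻¹) ((2 * (g y ^ 3)⁻¹) • fderiv ℝ g y) y := by
      intro y hy
      have hgy := hpos y hy
      have h1 := ((hgC y hy).differentiableAt (by simp)).hasFDerivAt.pow 2
      have h2 := ((hasDerivAt_inv (pow_ne_zero 2 hgy.ne')).comp_hasFDerivAt y h1).neg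
      refine h2.congr_fderiv ?_
      rw [smul_smul, ← neg_smul]
      congr 1
      field_simp
      ring
    have htwo : (2 : WithTop ℕ∞) ≤ ∞ := WithTop.coe_le_coe.2 le_top
    have hF : ∀ y ∈ U, fderiv ℝ (fderiv ℝ fun y ↦ (g y)⁻¹) y =
        (-(g y ^ 2)⁻¹) • fderiv ℝ (fderiv ℝ g) y +
          ((2 * (g y ^ 3)⁻¹) • fderiv ℝ g y).smulRight (fderiv ℝ g y) := by
      intro y hy
      have hev : (fderiv ℝ fun y ↦ (g y)⁻¹) =ᶠ[𝓝 y] fun y ↦ (-(g y ^ 2)⁻¹) • fderiv ℝ g y := by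
        filter_upwards [hUo.mem_nhds hy] with z hz
        exact hD1eq z hz
      rw [hev.fderiv_eq]
      have hdg : DifferentiableAt ℝ (fderiv ℝ g) y :=
        (((hgC y hy).of_le htwo).fderiv_right (m := 1) le_rfl).differentiableAt one_ne_zero
      rw [fderiv_fun_smul (hφd y hy).differentiableAt hdg, (hφd y hy).fderiv]
    have hle : ∀ᶠ y in cobounded E, ‖iteratedFDeriv ℝ 2 (fun y ↦ (g y)⁻¹) y‖ ≤
        ‖(g y ^ 2)⁻¹‖ * ‖fderiv ℝ (fderiv ℝ g) y‖ +
          ‖2 * (g y ^ 3)⁻¹‖ * (‖fderiv ℝ g y‖ * ‖fderiv ℝ g y‖) := by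
      filter_upwards [eventually_cobounded_lt_norm (E := E) R] with y hy
      rw [← norm_iteratedFDeriv_fderiv, norm_iteratedFDeriv_one, hF y hy]
      refine (norm_add_le ((-(g y ^ 2)⁻¹) • fderiv ℝ (fderiv ℝ g) y)
        (((2 * (g y ^ 3)⁻¹) • fderiv ℝ g y).smulRight (fderiv ℝ g y))).trans (add_le_add ?_ ?_)
      · refine (ContinuousLinearMap.opNorm_smul_le _ _).trans_eq ?_
        rw [norm_neg]
      · exact le_of_eq (by rw [ContinuousLinearMap.norm_smulRight_apply, norm_smul, mul_assoc])
    have hexpA : (fun y : E ↦ ‖y‖ ^ (-(2 * b)) * ‖y‖ ^ (b - 2)) =ᶠ[cobounded E]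
        fun y ↦ ‖y‖ ^ (-b - 2) := by
      rw [show -b - 2 = -(2 * b) + (b - 2) by ring]
      exact norm_rpow_mul_rpow_eventuallyEq (E := E) _ _
    have hexpB : (fun y : E ↦ ‖y‖ ^ (-(3 * b)) * (‖y‖ ^ (b - 1) * ‖y‖ ^ (b - 1))) =ᶠ[cobounded E]
        fun y ↦ ‖y‖ ^ (-b - 2) := by
      filter_upwards [eventually_cobounded_le_norm (E := E) 1] with y hy
      rw [← Real.rpow_add (by linarith), ← Real.rpow_add (by linarith)]
      congr 1
      ring
    rw [Nat.cast_ofNat]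
    refine (IsBigO.of_norm_eventuallyLE ?_).trans
      (((hφ.norm_left.mul hD2g).trans hexpA.isBigO).add
        (((hψ.const_mul_left 2).norm_left.mul (hDg.mul hDg)).trans hexpB.isBigO))
    filter_upwards [hle] with y hy
    exact (norm_norm (iteratedFDeriv ℝ 2 (fun y ↦ (g y)⁻¹) y)).trans_le hy

end IsBigOSmooth

end Literature.Geometry.Lorentzian

end
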